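import Literature.IUT.LogVolume.ExplicitEstimatesSzpiroConductorForm
import Literature.NumberTheory.EllipticCurves.LegendreSemistableReductionProofs
import Literature.NumberTheory.DiophantineGeometry.ConductorExponentZeroProofs
import Literature.NumberTheory.DiophantineGeometry.MinimalDiscriminantFiniteProofs
import Literature.NumberTheory.DiophantineGeometry.AbcGyory2008ThmTwoProofs
import Literature.RingTheory.DiscreteValuationRing.AdicCompletionResidueField
import HarnessLib

/-!
# [ExpEst] Remark 5.3.3, the recalled input (R0) CORRECTED and PROVED: `rad_L(λ, 1−λ, −1) ∣ 2^d·N(𝔣_{E_λ})`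
# for every number field `L` and every `λ ∈ L^⑂`; hence the displayed Szpiro line from (R1) + Thm 5.3 (i)
# alone, with `2^{12d}` replaced by `2^{(12+6ε)d}`

S. Mochizuki, I. Fesenko, Y. Hoshi, A. Minamide, W. Porowski, *Explicit estimates in inter-universal
Teichmüller theory*, Kodai Math. J. **45** (2022) 175–236 — [ExpEst], bib key `MochizukiEtAl2022` (claim
key, status disputed) — **Remark 5.3.3**, journal p. 222 l. 14 – p. 223 l. 4. PROOF-ONLY sequel of
`ExplicitEstimatesSzpiroConductorForm` (the typed remark: (R1) `Rmk533LocalBound`, (R0) `Rmk533RadLeConductor`,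
(R2) `Rmk533`, (R3) `Rmk533Product`, and the PROVED bookkeeping `log_minDisc_le_of_thm53i`). No definition, no
named fact, no instance. TAKES NO SIDE on [IUTchIII] Cor. 3.12 or on any author; typed ≠ proved ≠ endorsed;
no abc claim; no Szpiro claim (every Szpiro-shaped statement below is CONDITIONAL on Theorem 5.3 (i), a
claim-tagged CANDIDATE downstream of the disputed Cor. 3.12, and on the classical input (R1)).

Context (bookkeeping, `…SzpiroConductorFormSentencesProofs`): the recalled sentence (R0) "`N_{L/ℚ}(𝔣_{E_λ}) ≥
rad_L(λ, 1−λ, −1)`" (p. 222 l. 39–42) is false as printed at `(ℚ, −9/16)` (`15 < 30`): a place over `2` may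
lie in `I_L` while `E_λ` has good reduction there. What the sources the remark cites for (R0) DO give —
[Silv1] VII.5.4 (c) (reduction of the Legendre equation at places `v ∤ 2`) with [Silv2] IV.10.2 (a) (`f_v =
0 ⟺` good reduction) and the definition of `𝔣 = ∏ 𝔭_v^{f_v}` — is PROVED here in the tree's vocabulary:

* §1 `legendre_mem_badPrimes_iff_not_hasGoodReductionAt` — at a place `v` with `|2|_v = 1`: `v ∈ I_L(λ,
  1−λ, −1)` (the tree's `badPrimes λ (1−λ) (−1)`, = Thm 5.3's `I_L` through `radL_eq_radicalNorm`) **iff**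
  `E_λ` does NOT have good reduction at `v` (AEC VII.5.4 (c) = tree `legendre_hasGoodReductionAt_iff`); hence
  `f_v ≠ 0` and `𝔣_{E_λ} ≤ 𝔭_v` there (ATAEC IV.10.2 (a) = tree `conductorExponent_eq_zero_iff_holds`);
* §2 **(R0′) `radL_dvd_two_pow_mul_legendreCondNorm`: `rad_L(λ, 1−λ, −1) ∣ 2^d · N_{L/ℚ}(𝔣_{E_λ})`**, `d =
  [L:ℚ]`, for EVERY number field `L` and every `λ ≠ 0, 1` (the ideal `(2)·𝔣` lies below every `𝔭_v`, `v ∈ I_L`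
  — below `(2) ≤ 𝔭_v` if `v ∣ 2`, below `𝔣 ≤ 𝔭_v` if `v ∤ 2` — hence below `⨅ 𝔭_v = ∏ 𝔭_v`, and `N((2)) =
  2^d`); real forms `radL_le_two_pow_mul_legendreCondNorm`, `log_radL_le`;
* §3 **`legendreMinDiscNorm_le_of_thm53i`**: from (R1) and Theorem 5.3 (i) ALONE (no (R0)), for `L`
  mono-complex, `λ ≠ 0, 1`, `0 < ε ≤ 1`: `N(𝔇_{E_λ}) ≤ 2^{(12+6ε)d}·Δ_L^{6(1+ε)}·exp(d·h_d(ε))·N(𝔣_{E_λ})^{6(1+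
  ε)}` — the printed product line (R3) with `2^{12d}` replaced by `2^{(12+6ε)d}` (the price of the `2`-part of
  `rad_L`), by the printed bookkeeping (`log_minDisc_le_of_thm53i`) with (R0′) in place of (R0); and
  `szpiroShape_legendre_of_thm53i`: the Szpiro SHAPE `N(𝔇) ≤ C(L,ε′)·N(𝔣)^{6+ε′}` on the Legendre family over
  `L` from `∀λ (R1)` and `∀λ∀ε Thm 5.3 (i)` — the exact content of "an explicit version of … [Szp] CONJECTURE
  1 forme forte, in the case of `L` and `E_λ`" (p. 223 l. 1–4), now resting on (R1) and Theorem 5.3 (i) only.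

* §4 (appended) `rmk533RadLeConductor_of_not_hasGoodReductionAt_above_two`: the printed (R0) itself HOLDS
  (as `rad_L ∣ N(𝔣)`) whenever `E_λ` has bad reduction at every place above `2` that lies in `I_L` — the exact
  proviso missing in print (its failure at `(ℚ, −9/16)` is a place `2 ∈ I_ℚ` of good reduction).

NOT-IN-PRINT as displayed formulas: (R0′) and the constant `2^{(12+6ε)d}` are this file's (classical, proved)
corrections; the printed (R0)/(R2)/(R3) stay typed verbatim upstream. Conditional theorems discharge nothing
they bind. Nothing here bears on Thm 5.1, Cor 5.2, Thm 5.3/5.4 of [ExpEst] or on [IUTchIII] Cor. 3.12.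
-/

noncomputable section

open NumberField IsDedekindDomain WeierstrassCurve
open Literature.NumberTheory.DiophantineGeometry Literature.NumberTheory.EllipticCurves

namespace Literature.IUT.LogVolume

namespace ExpEst

open Real Cor22

variable {L : Type*} [Field L] [NumberField L]

/-! ## 1. Exceptional places of `(λ, 1−λ, −1)` away from `2` are places of bad reduction of `E_λ` -/

/-- Unfolding Thm 5.3's exceptional set at `(a,b,c) = (λ, 1−λ, −1)`: `v ∈ I_L(λ, 1−λ, −1)` (the valuations of
`λ, 1−λ, −1` not all equal) iff NOT (`|λ|_v = 1` and `|λ − 1|_v = 1`) (`|−1|_v = 1`, `|1 − λ|_v = |λ − 1|_v`).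
[cite: MochizukiEtAl2022, Thm 5.3 p. 219 (definition of `I_L`)] -/
theorem mem_badPrimes_legendre_iff (v : HeightOneSpectrum (𝓞 L)) (lam : L) :
    v ∈ badPrimes lam (1 - lam) (-1) ↔ ¬ (v.valuation L lam = 1 ∧ v.valuation L (lam - 1) = 1) := by
  simp only [badPrimes, Set.mem_setOf_eq, Valuation.map_neg, Valuation.map_one]
  rw [show (1 - lam) = -(lam - 1) by ring, Valuation.map_neg]
  refine not_congr ⟨?_, ?_⟩
  · rintro ⟨h1, h2⟩; exact ⟨h1.trans h2, h2⟩
  · rintro ⟨h1, h2⟩; exact ⟨h1.trans h2.symm, h2⟩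

/-- `E_λ = ⟨0, −(1+λ), 0, λ, 0⟩` is an elliptic curve for `λ ≠ 0, 1` (tree `legendre_isElliptic_iff`; a theorem
used via `haveI`). [cite: SilvermanAEC2009, Prop. III.1.7] -/
theorem isElliptic_legendre_of_ne {lam : L} (h0 : lam ≠ 0) (h1 : lam ≠ 1) :
    (⟨0, -(1 + lam), 0, lam, 0⟩ : WeierstrassCurve L).IsElliptic :=
  (legendre_isElliptic_iff two_ne_zero lam).mpr ⟨h0, h1⟩

/-- **[Silv1] VII.5.4 (c) read against Thm 5.3's `I_L`**: at a finite place `v` of `L` with `|2|_v = 1`, `v ∈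
I_L(λ, 1−λ, −1)` iff `E_λ : y² = x(x−1)(x−λ)` does NOT have good reduction at `v` (good reduction at `v ∤ 2`
⟺ `λ, λ − 1` are `v`-units, tree `legendre_hasGoodReductionAt_iff`).
[cite: SilvermanAEC2009, proof of Prop. VII.5.4(c) (PDF pp. 176–177)] -/
theorem legendre_mem_badPrimes_iff_not_hasGoodReductionAt (v : HeightOneSpectrum (𝓞 L)) {lam : L}
    (h0 : lam ≠ 0) (h1 : lam ≠ 1) (h2 : v.valuation L (2 : L) = 1) :
    v ∈ badPrimes lam (1 - lam) (-1) ↔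
      ¬ (⟨0, -(1 + lam), 0, lam, 0⟩ : WeierstrassCurve L).HasGoodReductionAt v := by
  haveI := isElliptic_legendre_of_ne h0 h1
  rw [mem_badPrimes_legendre_iff, legendre_hasGoodReductionAt_iff v h2]

/-- If `f_v ≠ 0` then `𝔣 ≤ 𝔭_v`: the conductor ideal `∏ᶠ 𝔭_w^{f_w}` is a genuine finite product (`f_w ≤
ord_w(Δ_min)`, finitely many non-zero: tree `finite_setOf_ordMinimalDiscriminant_ne_zero_holds`), one factor
of which is `𝔭_v^{f_v} ≤ 𝔭_v` (private plumbing; same argument as the tree's DH files). [folklore] -/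
private theorem conductor_le_of_conductorExponent_ne_zero {A : Type*} [CommRing A] [IsDedekindDomain A]
    {K : Type*} [Field K] [Algebra A K] [IsFractionRing A K] (W : WeierstrassCurve K) [W.IsElliptic]
    (v : HeightOneSpectrum A) (hv : W.conductorExponent v ≠ 0) : W.conductor A ≤ v.asIdeal := by
  classical
  have hfin : {w : HeightOneSpectrum A | W.conductorExponent w ≠ 0}.Finite :=
    (WeierstrassCurve.finite_setOf_ordMinimalDiscriminant_ne_zero_holds (A := A) W).subset
      fun w hw h => hw (Nat.eq_zero_of_le_zero
        (h ▸ WeierstrassCurve.conductorExponent_le_ordMinimalDiscriminant w W))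
  have hsub : (Function.mulSupport fun w : HeightOneSpectrum A => w.asIdeal ^ W.conductorExponent w) ⊆
      hfin.toFinset := by
    intro w hw
    rw [Function.mem_mulSupport] at hw
    simp only [Set.Finite.coe_toFinset, Set.mem_setOf_eq]
    intro h0
    exact hw (by rw [h0, pow_zero])
  have hmem : v ∈ hfin.toFinset := by simpa using hv
  rw [WeierstrassCurve.conductor, finprod_eq_prod_of_mulSupport_subset _ hsub]
  calc ∏ w ∈ hfin.toFinset, w.asIdeal ^ W.conductorExponent w
      ≤ hfin.toFinset.inf (fun w => w.asIdeal ^ W.conductorExponent w) := Ideal.prod_le_inf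
    _ ≤ v.asIdeal ^ W.conductorExponent v := Finset.inf_le hmem
    _ ≤ v.asIdeal := Ideal.pow_le_self hv

/-- **[Silv2] IV.10.2 (a) at the exceptional places away from `2`**: if `|2|_v = 1` and `v ∈ I_L(λ, 1−λ, −1)`
then `f_v(E_λ) ≠ 0`, so the conductor ideal satisfies `𝔣_{E_λ} ≤ 𝔭_v` (`𝔭_v ∣ 𝔣_{E_λ}`). The residue field at
`v` is finite, hence perfect (the standing hypothesis of the tree's Tate/Ogg conductor).
[cite: Silverman1994, IV.10.2(a)] -/
theorem legendre_conductor_le_of_mem_badPrimes (v : HeightOneSpectrum (𝓞 L)) {lam : L} (h0 : lam ≠ 0)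
    (h1 : lam ≠ 1) (h2 : v.valuation L (2 : L) = 1) (hv : v ∈ badPrimes lam (1 - lam) (-1)) :
    (⟨0, -(1 + lam), 0, lam, 0⟩ : WeierstrassCurve L).conductor (𝓞 L) ≤ v.asIdeal := by
  haveI := isElliptic_legendre_of_ne h0 h1
  refine conductor_le_of_conductorExponent_ne_zero _ v fun hf => ?_
  exact (legendre_mem_badPrimes_iff_not_hasGoodReductionAt v h0 h1 h2).mp hv
    ((conductorExponent_eq_zero_iff_holds v _).mp hf)

/-! ## 2. (R0′): `rad_L(λ, 1−λ, −1) ∣ 2^d · N_{L/ℚ}(𝔣_{E_λ})` -/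

/-- `|2|_v = 1` at a place not containing `2`. [folklore] -/
private theorem valuation_two_eq_one_of_not_mem (v : HeightOneSpectrum (𝓞 L)) (h : (2 : 𝓞 L) ∉ v.asIdeal) :
    v.valuation L (2 : L) = 1 := by
  rw [← map_ofNat (algebraMap (𝓞 L) L) 2, HeightOneSpectrum.valuation_of_algebraMap]
  exact HeightOneSpectrum.intValuation_eq_one_iff.mpr h

/-- **The ideal `(2)·𝔣_{E_λ}` lies below every exceptional place**: for `v ∈ I_L(λ, 1−λ, −1)`, `(2)·𝔣 ≤ 𝔭_v` —
if `2 ∈ 𝔭_v` because `(2) ≤ 𝔭_v`, otherwise because `𝔣 ≤ 𝔭_v` (§1). [cite: Silverman1994, IV.10.2(a)] -/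
theorem span_two_mul_conductor_le_of_mem_badPrimes (v : HeightOneSpectrum (𝓞 L)) {lam : L} (h0 : lam ≠ 0)
    (h1 : lam ≠ 1) (hv : v ∈ badPrimes lam (1 - lam) (-1)) :
    Ideal.span {(2 : 𝓞 L)} * (⟨0, -(1 + lam), 0, lam, 0⟩ : WeierstrassCurve L).conductor (𝓞 L) ≤ v.asIdeal := by
  by_cases h2 : (2 : 𝓞 L) ∈ v.asIdeal
  · exact Ideal.mul_le_right.trans ((Ideal.span_singleton_le_iff_mem _).mpr h2)
  · exact Ideal.mul_le_left.trans
      (legendre_conductor_le_of_mem_badPrimes v h0 h1 (valuation_two_eq_one_of_not_mem v h2) hv)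

/-- `N_{L/ℚ}((2)) = 2^{[L:ℚ]}`. [folklore] -/
private theorem absNorm_span_two : Ideal.absNorm (Ideal.span {(2 : 𝓞 L)}) = 2 ^ Module.finrank ℚ L := by
  rw [show (2 : 𝓞 L) = ((2 : ℕ) : 𝓞 L) by norm_num, Ideal.absNorm_span_natCast, RingOfIntegers.rank]

/-- **(R0′) — the corrected form of the recalled input (R0), PROVED for every number field `L` and every `λ ≠
0, 1`: `rad_L(λ, 1−λ, −1) ∣ 2^{[L:ℚ]} · N_{L/ℚ}(𝔣_{E_λ})`.** (`rad_L` = Thm 5.3's `radL` = `∏_{v ∈ I_L} N(𝔭_v)`;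
the `𝔭_v`, `v ∈ I_L`, are distinct maximal ideals all lying above `(2)·𝔣` (previous theorem), so `∏ 𝔭_v = ⨅ 𝔭_v ∣
(2)·𝔣`, and `N` is multiplicative.) What [Silv1] VII.5.4 (c) + [Silv2] IV.10.2 (a) give; the printed (R0) is
the same sentence without the factor `2^d` (false at `(ℚ, −9/16)`). NOT-IN-PRINT as displayed.
[cite: SilvermanAEC2009, proof of Prop. VII.5.4(c) (PDF pp. 176–177)] [cite: Silverman1994, IV.10.2(a)] -/
theorem radL_dvd_two_pow_mul_legendreCondNorm {lam : L} (h0 : lam ≠ 0) (h1 : lam ≠ 1) :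
    radL lam (1 - lam) (-1) ∣ 2 ^ Module.finrank ℚ L * legendreCondNorm lam := by
  classical
  have hfin := Gyory2008.badPrimes_finite h0 (sub_ne_zero.mpr (Ne.symm h1)) (neg_ne_zero.mpr (one_ne_zero' L))
  set T := hfin.toFinset with hT
  -- `(2)·𝔣 ≤ ⨅_{v ∈ T} 𝔭_v = ∏_{v ∈ T} 𝔭_v`
  have hle : Ideal.span {(2 : 𝓞 L)} * (⟨0, -(1 + lam), 0, lam, 0⟩ : WeierstrassCurve L).conductor (𝓞 L) ≤
      T.inf fun v => v.asIdeal ^ (1 : ℕ) :=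
    Finset.le_inf fun v hv => by
      rw [pow_one]
      exact span_two_mul_conductor_le_of_mem_badPrimes v h0 h1 (hfin.mem_toFinset.mp hv)
  rw [IsDedekindDomain.inf_pow_eq_prod_of_prime T (fun v => v.asIdeal) (fun _ => 1) (fun v _ => v.prime)
    (fun _ _ _ _ hvw heq => hvw (HeightOneSpectrum.ext heq))] at hle
  have hdvd := Ideal.absNorm_dvd_absNorm_of_le hle
  rw [map_mul, map_prod, absNorm_span_two] at hdvd
  simp only [pow_one] at hdvd
  rw [radL_eq_radicalNorm, legendreCondNorm_def, WeierstrassCurve.conductorNorm]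
  unfold radicalNorm
  rwa [finprod_mem_eq_finite_toFinset_prod _ hfin]

/-- (R0′), real form: `rad_L(λ, 1−λ, −1) ≤ 2^d · N_{L/ℚ}(𝔣_{E_λ})` (`N(𝔣) ≥ 1`). NOT-IN-PRINT as displayed.
[cite: SilvermanAEC2009, proof of Prop. VII.5.4(c) (PDF pp. 176–177)] [cite: Silverman1994, IV.10.2(a)] -/
theorem radL_le_two_pow_mul_legendreCondNorm {lam : L} (h0 : lam ≠ 0) (h1 : lam ≠ 1) :
    (radL lam (1 - lam) (-1) : ℝ) ≤ (2 : ℝ) ^ Module.finrank ℚ L * (legendreCondNorm lam : ℝ) := by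
  have h := Nat.le_of_dvd (Nat.mul_pos (Nat.pow_pos two_pos) (legendreCondNorm_pos lam))
    (radL_dvd_two_pow_mul_legendreCondNorm h0 h1)
  exact_mod_cast h

/-- (R0′), logarithmic form: `log rad_L ≤ d·log 2 + log N(𝔣_{E_λ})`. NOT-IN-PRINT as displayed.
[cite: SilvermanAEC2009, proof of Prop. VII.5.4(c) (PDF pp. 176–177)] [cite: Silverman1994, IV.10.2(a)] -/
theorem log_radL_le {lam : L} (h0 : lam ≠ 0) (h1 : lam ≠ 1) :
    Real.log (radL lam (1 - lam) (-1) : ℝ) ≤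
      (Module.finrank ℚ L : ℝ) * Real.log 2 + Real.log (legendreCondNorm lam : ℝ) := by
  have hR : (0 : ℝ) < (radL lam (1 - lam) (-1) : ℝ) := by exact_mod_cast one_le_radL lam (1 - lam) (-1)
  have hN : (0 : ℝ) < (legendreCondNorm lam : ℝ) := by exact_mod_cast legendreCondNorm_pos lam
  have h := Real.log_le_log hR (radL_le_two_pow_mul_legendreCondNorm h0 h1)
  rwa [Real.log_mul (by positivity) hN.ne', Real.log_pow] at h

/-! ## 3. The displayed Szpiro line from (R1) and Theorem 5.3 (i) alone, constant `2^{(12+6ε)d}` -/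

/-- A natural number whose logarithm is at most `log y`, `y > 0`, is at most `y` (private plumbing). [folklore] -/
private theorem natCast_le_of_log_le' {n : ℕ} {y : ℝ} (hy : 0 < y) (h : Real.log (n : ℝ) ≤ Real.log y) :
    (n : ℝ) ≤ y := by
  rcases Nat.eq_zero_or_pos n with hn | hn
  · rw [hn, Nat.cast_zero]; exact hy.le
  · exact (Real.log_le_log_iff (by exact_mod_cast hn) hy).1 h

/-- **The product line with the corrected input: (R1) + Theorem 5.3 (i) ⟹ `N_{L/ℚ}(𝔇_{E_λ}) ≤ 2^{(12+6ε)d}·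
Δ_L^{6(1+ε)}·exp(d·h_d(ε))·N_{L/ℚ}(𝔣_{E_λ})^{6(1+ε)}`** for `L` mono-complex, `λ ≠ 0, 1`, `0 < ε ≤ 1` — the printed
bookkeeping (`log_minDisc_le_of_thm53i`: `log N(𝔇) ≤ 12d·log 2 + max{6(1+ε)·log(Δ_L·rad_L), d·h_d} + 6(log N(𝔣) −
log rad_L)`, then `max ≤ sum`) fed with (R0′) `log rad_L ≤ d·log 2 + log N(𝔣)` instead of (R0): the surplus
`6ε·log rad_L ≤ 6ε·(d log 2 + log N(𝔣))` moves `2^{12d}` to `2^{(12+6ε)d}`. A conditional theorem (it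
discharges neither (R1) nor Theorem 5.3 (i)); NOT-IN-PRINT with this constant; no Szpiro claim.
[cite: MochizukiEtAl2022, Rmk 5.3.3 p. 222 l. 34–47] -/
theorem legendreMinDiscNorm_le_of_thm53i {lam : L} {ε : ℝ} (hR1 : Rmk533LocalBound lam)
    (h53 : Thm53i L lam (1 - lam) (-1) ε) (hL : IsMonoComplex L) (h0 : lam ≠ 0) (h1 : lam ≠ 1)
    (hε : 0 < ε) (hε1 : ε ≤ 1) :
    (legendreMinDiscNorm lam : ℝ) ≤
      (2 : ℝ) ^ ((12 + 6 * ε) * (Module.finrank ℚ L : ℝ)) * (absDisc L : ℝ) ^ (6 * (1 + ε)) *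
        Real.exp ((Module.finrank ℚ L : ℝ) * hd (Module.finrank ℚ L) ε) *
          (legendreCondNorm lam : ℝ) ^ (6 * (1 + ε)) := by
  have hlog := log_minDisc_le_of_thm53i hL h0 h1 hε hε1 hR1 h53
  have hR0 := log_radL_le h0 h1
  -- positivity of the nouns
  have hR : (1 : ℝ) ≤ (radL lam (1 - lam) (-1) : ℝ) := by exact_mod_cast one_le_radL lam (1 - lam) (-1)
  have hΔ : (1 : ℝ) ≤ (absDisc L : ℝ) := by exact_mod_cast one_le_absDisc L
  have hN : (1 : ℝ) ≤ (legendreCondNorm lam : ℝ) := by exact_mod_cast legendreCondNorm_pos lam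
  have hRpos : (0 : ℝ) < (radL lam (1 - lam) (-1) : ℝ) := by linarith
  have hΔpos : (0 : ℝ) < (absDisc L : ℝ) := by linarith
  have hNpos : (0 : ℝ) < (legendreCondNorm lam : ℝ) := by linarith
  have hd0 : (0 : ℝ) < (Module.finrank ℚ L : ℝ) := by exact_mod_cast Module.finrank_pos (R := ℚ) (M := L)
  have hhd : 0 ≤ hd (Module.finrank ℚ L) ε := hd_nonneg _ hε
  have hlogR : 0 ≤ Real.log (radL lam (1 - lam) (-1) : ℝ) := Real.log_nonneg hR
  have hlogΔ : 0 ≤ Real.log (absDisc L : ℝ) := Real.log_nonneg hΔ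
  have hlogN : 0 ≤ Real.log (legendreCondNorm lam : ℝ) := Real.log_nonneg hN
  have hlog2 : 0 ≤ Real.log 2 := Real.log_nonneg (by norm_num)
  have hlogmul : Real.log ((absDisc L : ℝ) * (radL lam (1 - lam) (-1) : ℝ)) =
      Real.log (absDisc L : ℝ) + Real.log (radL lam (1 - lam) (-1) : ℝ) :=
    Real.log_mul hΔpos.ne' hRpos.ne'
  have hmaxle : max (6 * (1 + ε) * Real.log ((absDisc L : ℝ) * (radL lam (1 - lam) (-1) : ℝ)))
        ((Module.finrank ℚ L : ℝ) * hd (Module.finrank ℚ L) ε) ≤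
      6 * (1 + ε) * (Real.log (absDisc L : ℝ) + Real.log (radL lam (1 - lam) (-1) : ℝ)) +
        (Module.finrank ℚ L : ℝ) * hd (Module.finrank ℚ L) ε := by
    rw [hlogmul]
    refine max_le ?_ ?_
    · have : 0 ≤ (Module.finrank ℚ L : ℝ) * hd (Module.finrank ℚ L) ε := mul_nonneg hd0.le hhd
      linarith
    · have : 0 ≤ 6 * (1 + ε) * (Real.log (absDisc L : ℝ) + Real.log (radL lam (1 - lam) (-1) : ℝ)) := by
        positivity
      linarith
  -- the logarithm of the right-hand side
  set RHS := (2 : ℝ) ^ ((12 + 6 * ε) * (Module.finrank ℚ L : ℝ)) * (absDisc L : ℝ) ^ (6 * (1 + ε)) *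
    Real.exp ((Module.finrank ℚ L : ℝ) * hd (Module.finrank ℚ L) ε) *
      (legendreCondNorm lam : ℝ) ^ (6 * (1 + ε)) with hRHS
  have h2pow : (0 : ℝ) < (2 : ℝ) ^ ((12 + 6 * ε) * (Module.finrank ℚ L : ℝ)) := Real.rpow_pos_of_pos two_pos _
  have hRHSpos : 0 < RHS := by positivity
  have hlogRHS : Real.log RHS = (12 + 6 * ε) * (Module.finrank ℚ L : ℝ) * Real.log 2 +
      6 * (1 + ε) * Real.log (absDisc L : ℝ) + (Module.finrank ℚ L : ℝ) * hd (Module.finrank ℚ L) ε +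
        6 * (1 + ε) * Real.log (legendreCondNorm lam : ℝ) := by
    have hΔpow : (0 : ℝ) < (absDisc L : ℝ) ^ (6 * (1 + ε)) := Real.rpow_pos_of_pos hΔpos _
    have hexp : (0 : ℝ) < Real.exp ((Module.finrank ℚ L : ℝ) * hd (Module.finrank ℚ L) ε) :=
      Real.exp_pos _
    have hNpow : (0 : ℝ) < (legendreCondNorm lam : ℝ) ^ (6 * (1 + ε)) := Real.rpow_pos_of_pos hNpos _
    rw [hRHS, Real.log_mul (by positivity) hNpow.ne', Real.log_mul (by positivity) hexp.ne',
      Real.log_mul h2pow.ne' hΔpow.ne', Real.log_rpow two_pos, Real.log_rpow hΔpos, Real.log_exp,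
      Real.log_rpow hNpos]
  have hε6 : 0 ≤ 6 * ε := by linarith
  have hεlog : 6 * ε * Real.log (radL lam (1 - lam) (-1) : ℝ) ≤
      6 * ε * ((Module.finrank ℚ L : ℝ) * Real.log 2 + Real.log (legendreCondNorm lam : ℝ)) :=
    mul_le_mul_of_nonneg_left hR0 hε6
  have hfinal : Real.log (legendreMinDiscNorm lam : ℝ) ≤ Real.log RHS := by
    rw [hlogRHS]; nlinarith
  exact natCast_le_of_log_le' hRHSpos hfinal

/-- **Szpiro's inequality RESTRICTED TO THE LEGENDRE FAMILY over a mono-complex `L`, from (R1) and Theorem 5.3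
(i) alone**: if (R1) holds for every `λ ∈ L^⑂` and Theorem 5.3 (i) holds at `(λ, 1−λ, −1)` for every `λ ∈ L^⑂`
and every `ε`, then for every `ε′ > 0` there is `C = C(L, ε′)` — explicitly `2^{(12+6ε)d}·Δ_L^{6(1+ε)}·exp(d·
h_d(ε))`, `ε = min{1, ε′/6}` — with `N_{L/ℚ}(𝔇_{E_λ}) ≤ C·N_{L/ℚ}(𝔣_{E_λ})^{6+ε′}` for all `λ ≠ 0, 1`: the sense
of "an explicit version of … [Szp], §1, CONJECTURE 1 forme forte, in the case of `L` and `E_λ`" (p. 223 l.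
1–4), with the recalled (R0) no longer an input (replaced by the proved (R0′)). Conditional; it discharges
nothing it binds; no Szpiro claim. [cite: MochizukiEtAl2022, Rmk 5.3.3 p. 223 l. 1–4]
[cite: Silverman1994, Conj. IV.10.6] -/
theorem szpiroShape_legendre_of_thm53i (hL : IsMonoComplex L)
    (hR1 : ∀ lam : L, lam ≠ 0 → lam ≠ 1 → Rmk533LocalBound lam)
    (h53 : ∀ (lam : L) (ε : ℝ), Thm53i L lam (1 - lam) (-1) ε) :
    ∀ ε' : ℝ, 0 < ε' → ∃ C : ℝ, ∀ lam : L, lam ≠ 0 → lam ≠ 1 →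
      (((⟨0, -(1 + lam), 0, lam, 0⟩ : WeierstrassCurve L).minimalDiscriminantNorm (𝓞 L) : ℕ) : ℝ) ≤
        C * (((⟨0, -(1 + lam), 0, lam, 0⟩ : WeierstrassCurve L).conductorNorm (𝓞 L) : ℕ) : ℝ) ^ (6 + ε') := by
  intro ε' hε'
  set ε := min 1 (ε' / 6) with hεdef
  have hε : 0 < ε := lt_min one_pos (by linarith)
  have hε1 : ε ≤ 1 := min_le_left _ _
  have hε6 : 6 * (1 + ε) ≤ 6 + ε' := by have := min_le_right 1 (ε' / 6); linarith
  refine ⟨(2 : ℝ) ^ ((12 + 6 * ε) * (Module.finrank ℚ L : ℝ)) * (absDisc L : ℝ) ^ (6 * (1 + ε)) *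
    Real.exp ((Module.finrank ℚ L : ℝ) * hd (Module.finrank ℚ L) ε), fun lam h0 h1 => ?_⟩
  have h := legendreMinDiscNorm_le_of_thm53i (hR1 lam h0 h1) (h53 lam ε) hL h0 h1 hε hε1
  rw [legendreMinDiscNorm_def, legendreCondNorm_def] at h
  have hN : (1 : ℝ) ≤ (((⟨0, -(1 + lam), 0, lam, 0⟩ : WeierstrassCurve L).conductorNorm (𝓞 L) : ℕ) : ℝ) := by
    exact_mod_cast legendreCondNorm_pos lam
  have hpow : (((⟨0, -(1 + lam), 0, lam, 0⟩ : WeierstrassCurve L).conductorNorm (𝓞 L) : ℕ) : ℝ) ^ (6 * (1 + ε)) ≤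
      (((⟨0, -(1 + lam), 0, lam, 0⟩ : WeierstrassCurve L).conductorNorm (𝓞 L) : ℕ) : ℝ) ^ (6 + ε') :=
    Real.rpow_le_rpow_of_exponent_le hN hε6
  have hC : (0 : ℝ) ≤ (2 : ℝ) ^ ((12 + 6 * ε) * (Module.finrank ℚ L : ℝ)) * (absDisc L : ℝ) ^ (6 * (1 + ε)) *
      Real.exp ((Module.finrank ℚ L : ℝ) * hd (Module.finrank ℚ L) ε) := by positivity
  exact h.trans (mul_le_mul_of_nonneg_left hpow hC)

/-! ## 4. When the printed (R0) itself holds: the exceptional places above `2` are places of bad reduction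

(Appended, lit-abc-explicitiut g9.) The failure of (R0) at `(ℚ, −9/16)` comes from a place `v ∣ 2` lying in
`I_L` at which `E_λ` has GOOD reduction. Conversely, if at every place above `2` that lies in `I_L(λ, 1−λ, −1)`
the curve `E_λ` has bad reduction, the printed sentence (R0) is TRUE, even as a divisibility — the exact
scope of the recalled inequality, PROVED (classical; [Silv2] IV.10.2 (a) at every `v ∈ I_L`). -/

/-- **(R0) under its missing hypothesis**: if `E_λ` does not have good reduction at any place `v ∣ 2` lying in
`I_L(λ, 1−λ, −1)`, then `𝔣_{E_λ} ≤ 𝔭_v` for EVERY `v ∈ I_L` (above `2` by this hypothesis and [Silv2] IV.10.2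
(a); away from `2` by §1), so `rad_L(λ, 1−λ, −1) ∣ N_{L/ℚ}(𝔣_{E_λ})`. NOT-IN-PRINT with this hypothesis (the
print states (R0) unconditionally). [cite: Silverman1994, IV.10.2(a)]
[cite: MochizukiEtAl2022, Rmk 5.3.3 p. 222 l. 39–42] -/
theorem radL_dvd_legendreCondNorm_of_not_hasGoodReductionAt_above_two {lam : L} (h0 : lam ≠ 0)
    (h1 : lam ≠ 1)
    (h2 : ∀ v : HeightOneSpectrum (𝓞 L), (2 : 𝓞 L) ∈ v.asIdeal → v ∈ badPrimes lam (1 - lam) (-1) →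
      ¬ (⟨0, -(1 + lam), 0, lam, 0⟩ : WeierstrassCurve L).HasGoodReductionAt v) :
    radL lam (1 - lam) (-1) ∣ legendreCondNorm lam := by
  classical
  haveI := isElliptic_legendre_of_ne h0 h1
  have hfin := Gyory2008.badPrimes_finite h0 (sub_ne_zero.mpr (Ne.symm h1)) (neg_ne_zero.mpr (one_ne_zero' L))
  set T := hfin.toFinset with hT
  -- `𝔣 ≤ ⨅_{v ∈ T} 𝔭_v = ∏_{v ∈ T} 𝔭_v`
  have hle : (⟨0, -(1 + lam), 0, lam, 0⟩ : WeierstrassCurve L).conductor (𝓞 L) ≤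
      T.inf fun v => v.asIdeal ^ (1 : ℕ) :=
    Finset.le_inf fun v hv => by
      rw [pow_one]
      have hv' := hfin.mem_toFinset.mp hv
      by_cases hv2 : (2 : 𝓞 L) ∈ v.asIdeal
      · exact conductor_le_of_conductorExponent_ne_zero _ v fun hf =>
          h2 v hv2 hv' ((conductorExponent_eq_zero_iff_holds v _).mp hf)
      · exact legendre_conductor_le_of_mem_badPrimes v h0 h1 (valuation_two_eq_one_of_not_mem v hv2) hv'
  rw [IsDedekindDomain.inf_pow_eq_prod_of_prime T (fun v => v.asIdeal) (fun _ => 1) (fun v _ => v.prime)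
    (fun _ _ _ _ hvw heq => hvw (HeightOneSpectrum.ext heq))] at hle
  have hdvd := Ideal.absNorm_dvd_absNorm_of_le hle
  rw [map_prod] at hdvd
  simp only [pow_one] at hdvd
  rw [radL_eq_radicalNorm, legendreCondNorm_def, WeierstrassCurve.conductorNorm]
  unfold radicalNorm
  rwa [finprod_mem_eq_finite_toFinset_prod _ hfin]

/-- **The printed (R0) `N_{L/ℚ}(𝔣_{E_λ}) ≥ rad_L(λ, 1−λ, −1)` HOLDS whenever `E_λ` has bad reduction at every place
above `2` lying in `I_L(λ, 1−λ, −1)`** (in particular whenever `E_λ` has bad reduction at all places above `2`):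
the typed hypothesis predicate `Rmk533RadLeConductor λ` discharged under that (classical, NOT-IN-PRINT)
proviso — together with `…SentencesProofs` (failure at `(ℚ, −9/16)`, where `E_λ` is good at `2 ∈ I_ℚ`) this
delimits the recalled sentence. [cite: MochizukiEtAl2022, Rmk 5.3.3 p. 222 l. 39–42] [cite: Silverman1994, IV.10.2(a)] -/
theorem rmk533RadLeConductor_of_not_hasGoodReductionAt_above_two {lam : L} (h0 : lam ≠ 0) (h1 : lam ≠ 1)
    (h2 : ∀ v : HeightOneSpectrum (𝓞 L), (2 : 𝓞 L) ∈ v.asIdeal → v ∈ badPrimes lam (1 - lam) (-1) →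
      ¬ (⟨0, -(1 + lam), 0, lam, 0⟩ : WeierstrassCurve L).HasGoodReductionAt v) :
    Rmk533RadLeConductor lam := by
  unfold Rmk533RadLeConductor
  exact_mod_cast Nat.le_of_dvd (legendreCondNorm_pos lam)
    (radL_dvd_legendreCondNorm_of_not_hasGoodReductionAt_above_two h0 h1 h2)

/-- The same with the simpler (stronger) proviso "`E_λ` has bad reduction at every place above `2`".
[cite: MochizukiEtAl2022, Rmk 5.3.3 p. 222 l. 39–42] [cite: Silverman1994, IV.10.2(a)] -/
theorem rmk533RadLeConductor_of_forall_above_two {lam : L} (h0 : lam ≠ 0) (h1 : lam ≠ 1)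
    (h2 : ∀ v : HeightOneSpectrum (𝓞 L), (2 : 𝓞 L) ∈ v.asIdeal →
      ¬ (⟨0, -(1 + lam), 0, lam, 0⟩ : WeierstrassCurve L).HasGoodReductionAt v) :
    Rmk533RadLeConductor lam :=
  rmk533RadLeConductor_of_not_hasGoodReductionAt_above_two h0 h1 fun v hv _ => h2 v hv

end ExpEst

end Literature.IUT.LogVolume
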